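import Summits.Ventures.PercRepro.C025ProfileThinRowA

/-!
# THE ROW `(q, q+1)` ON THE ONE-SHORT-CIRCUIT CLASS 𝒞(q) — part A: STRUCTURE AND (Dem) (night-3 g14)
`proofs/NIGHT3-G14-SIZE.md` §5c. A finite matroid with a 3-circuit `K` (`K ⊆ E`, `|K| = 3`, `ρ(K) = 2`) such that EVERY set of
at most `q + 2` points not containing `K` is independent (`hclass`) — the class of g13's `M_q` + generic points, for EVERY size,
including `n = 2q + 2` where the simple rule of ThinRow A–E fails — satisfies the row `(q, q+1)` of C-032 and its Hall form, for every
`q ≥ 2`. STRUCTURE (`rank_q_cases`, `rank_succ_cases`): a set containing `K` with `≤ q + 2` points has rank `|X| − 1`, a set with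
`≥ q + 3` points has rank `≥ q + 2`; so the rank-`q` sets are the `q`-sets with `≤ 2` points of `K` and the `(q+1)`-sets containing `K`,
the rank-`(q+1)` sets are the `(q+1)`-sets with `≤ 2` points of `K` and the `(q+2)`-sets containing `K`. THE RULE pays by TYPE only (the
number of points of `K` in `B` and in `S`, and the cardinalities): `a → Q: 1`, `2K → I: s_I`, `2K → Q: s_Q`, `G → I: g_I`, `G → J: g_J`,
`Z → J: z_J`, `Z → free: z_F`; `profileIneq_oneCircuit_of_weights` proves the row for ANY weights with the (Dem) / (Cap) arithmetic
(`f := n − q − 1`: `f (s_I + s_Q) ≥ f + 1`, `2 g_I + (f−1) g_J ≥ f + 1`, `3 z_J + (f−2) z_F ≥ f`; `(q+1) z_F ≤ q+1`, `z_J + q g_J ≤ q+1`,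
`2 g_I + (q−1) s_I ≤ q+1`, `(q−1) + 3(q−1) s_Q ≤ q+1`), and `profileIneq_oneCircuit` / `hallIneq_oneCircuit` plug in the cascade
weights of `C025ProfileCascadeArith` (`cascade_weights`, every `f ≥ q`) — or the zero certificate when `f < q` (nothing is demanding).
No `def`, no `instance`, no notation; the weight is an explicit `if`-chain on cardinalities. PART A (this file): the structure of
𝒞(q) (`rank_q_cases`, `rank_succ_cases`, the `crk` bounds) and (Dem) for the four demander types (`dem_a`, `dem_twoK`, `dem_small`),
for an ABSTRACT weight `w` given by its values on the types; part B: (Cap) for the two set shapes and the theorems.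
-/
open scoped Matroid
namespace PercRepro
open Set Finset ThmH Staged
namespace OneCircuit
variable {α : Type} [DecidableEq α] {M : Matroid α} [M.Finite]

/-- Submodularity in `ℕ`: `ρ(X ∪ Y) ≤ ρ(X) + ρ(Y)`. -/
theorem rkN_union_le_add (X Y : Finset α) : rkN M (X ∪ Y) ≤ rkN M X + rkN M Y := by
  have h := M.eRk_union_le_eRk_add_eRk (X : Set α) (Y : Set α)
  rw [← Finset.coe_union, ← coe_rkN (X ∪ Y), ← coe_rkN X, ← coe_rkN Y] at h
  exact_mod_cast h

/-- A set containing the 3-circuit `K` has rank at most `|X| − 1`. -/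
theorem rkN_add_one_le_card_of_subset {K X : Finset α} (hK3 : K.card = 3) (hKrk : rkN M K = 2) (hKX : K ⊆ X) :
    rkN M X + 1 ≤ X.card := by
  have h1 : K ∪ (X \ K) = X := Finset.union_sdiff_of_subset hKX
  have h2 : rkN M X ≤ rkN M K + rkN M (X \ K) := by
    calc rkN M X = rkN M (K ∪ (X \ K)) := by rw [h1]
      _ ≤ rkN M K + rkN M (X \ K) := rkN_union_le_add K (X \ K)
  have h3 : rkN M (X \ K) ≤ (X \ K).card := rkN_le_card _
  have h4 : (X \ K).card = X.card - K.card := Finset.card_sdiff_of_subset hKX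
  have h5 : K.card ≤ X.card := Finset.card_le_card hKX
  omega

/-- In 𝒞(q) a set containing `K` with at most `q + 2` points has rank exactly `|X| − 1`. -/
theorem rkN_add_one_eq_card_of_subset {q : ℕ} {K : Finset α} (hK3 : K.card = 3) (hKrk : rkN M K = 2)
    (hclass : ∀ X ⊆ gr M, X.card ≤ q + 2 → ¬ K ⊆ X → rkN M X = X.card)
    {X : Finset α} (hXg : X ⊆ gr M) (hXc : X.card ≤ q + 2) (hKX : K ⊆ X) : rkN M X + 1 = X.card := by
  have hup := rkN_add_one_le_card_of_subset hK3 hKrk hKX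
  obtain ⟨k, hk⟩ : K.Nonempty := Finset.card_pos.mp (by omega)
  have hkX : k ∈ X := hKX hk
  have hlow : rkN M (X.erase k) = (X.erase k).card := by
    apply hclass _ ((Finset.erase_subset k X).trans hXg)
    · rw [Finset.card_erase_of_mem hkX]; omega
    · intro h; exact (Finset.notMem_erase k X) (h hk)
  have h2 : rkN M (X.erase k) ≤ rkN M X := rkN_mono (Finset.erase_subset k X)
  rw [Finset.card_erase_of_mem hkX] at hlow
  omega

/-- In 𝒞(q) a set with at least `q + 3` points has rank at least `q + 2`. -/
theorem rkN_ge_of_card_ge {q : ℕ} {K : Finset α} (hK3 : K.card = 3)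
    (hclass : ∀ X ⊆ gr M, X.card ≤ q + 2 → ¬ K ⊆ X → rkN M X = X.card)
    {X : Finset α} (hXg : X ⊆ gr M) (hXc : q + 3 ≤ X.card) : q + 2 ≤ rkN M X := by
  have hY : ∃ Y ⊆ X, Y.card = q + 2 ∧ ¬ K ⊆ Y := by
    by_cases hKX : K ⊆ X
    · obtain ⟨k, hk⟩ : K.Nonempty := Finset.card_pos.mp (by omega)
      have hkX : k ∈ X := hKX hk
      obtain ⟨Y, hYX, hYc⟩ := Finset.exists_subset_card_eq
        (show q + 2 ≤ (X.erase k).card by rw [Finset.card_erase_of_mem hkX]; omega)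
      exact ⟨Y, hYX.trans (Finset.erase_subset k X), hYc, fun h => (Finset.notMem_erase k X) (hYX (h hk))⟩
    · obtain ⟨Y, hYX, hYc⟩ := Finset.exists_subset_card_eq (show q + 2 ≤ X.card by omega)
      exact ⟨Y, hYX, hYc, fun h => hKX (h.trans hYX)⟩
  obtain ⟨Y, hYX, hYc, hKY⟩ := hY
  have h1 := hclass Y (hYX.trans hXg) (by omega) hKY
  have h2 : rkN M Y ≤ rkN M X := rkN_mono hYX
  omega

/-- **The rank-`q` sets of 𝒞(q)**: the `q`-sets not containing `K` and the `(q+1)`-sets containing `K`. -/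
theorem rank_q_cases {q : ℕ} {K : Finset α} (hK3 : K.card = 3) (hKrk : rkN M K = 2)
    (hclass : ∀ X ⊆ gr M, X.card ≤ q + 2 → ¬ K ⊆ X → rkN M X = X.card)
    {B : Finset α} (hBg : B ⊆ gr M) (hB : rkN M B = q) :
    (B.card = q ∧ ¬ K ⊆ B) ∨ (B.card = q + 1 ∧ K ⊆ B) := by
  rcases Nat.lt_or_ge (q + 2) B.card with hbig | hsmall
  · have := rkN_ge_of_card_ge hK3 hclass hBg (by omega); omega
  · by_cases hKB : K ⊆ B
    · right; have := rkN_add_one_eq_card_of_subset hK3 hKrk hclass hBg hsmall hKB; exact ⟨by omega, hKB⟩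
    · left; have := hclass B hBg hsmall hKB; exact ⟨by omega, hKB⟩

/-- **The rank-`(q+1)` sets of 𝒞(q)**: the `(q+1)`-sets not containing `K` and the `(q+2)`-sets containing `K`. -/
theorem rank_succ_cases {q : ℕ} {K : Finset α} (hK3 : K.card = 3) (hKrk : rkN M K = 2)
    (hclass : ∀ X ⊆ gr M, X.card ≤ q + 2 → ¬ K ⊆ X → rkN M X = X.card)
    {S : Finset α} (hSg : S ⊆ gr M) (hS : rkN M S = q + 1) :
    (S.card = q + 1 ∧ ¬ K ⊆ S) ∨ (S.card = q + 2 ∧ K ⊆ S) := by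
  rcases Nat.lt_or_ge (q + 2) S.card with hbig | hsmall
  · have := rkN_ge_of_card_ge hK3 hclass hSg (by omega); omega
  · by_cases hKS : K ⊆ S
    · right; have := rkN_add_one_eq_card_of_subset hK3 hKrk hclass hSg hsmall hKS; exact ⟨by omega, hKS⟩
    · left; have := hclass S hSg hsmall hKS; exact ⟨by omega, hKS⟩

/-- `K ⊆ B` iff `|B ∩ K| = 3` (for `|K| = 3`). -/
theorem subset_iff_card_inter_eq {K B : Finset α} (hK3 : K.card = 3) : K ⊆ B ↔ (B ∩ K).card = 3 := by
  constructor
  · intro h; rw [Finset.inter_eq_right.mpr h]; exact hK3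
  · intro h
    have hsub : B ∩ K ⊆ K := Finset.inter_subset_right
    have heq : B ∩ K = K := Finset.eq_of_subset_of_card_le hsub (by omega)
    intro k hk; rw [← heq] at hk; exact (Finset.mem_inter.mp hk).1

/-- `ρ(E ∖ B) + |B| ≤ |E|`. -/
theorem crk_add_card_le (B : Finset α) (hBg : B ⊆ gr M) : crk M B + B.card ≤ (gr M).card := by
  have h1 : crk M B ≤ (gr M \ B).card := rkN_le_card _
  have h2 : (gr M \ B).card = (gr M).card - B.card := Finset.card_sdiff_of_subset hBg
  have h3 : B.card ≤ (gr M).card := Finset.card_le_card hBg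
  omega

/-- `ρ(E ∖ B) + |B| + 1 ≤ |E|` when `B` misses the circuit `K`. -/
theorem crk_add_card_add_one_le {K B : Finset α} (hK3 : K.card = 3) (hKrk : rkN M K = 2) (hKg : K ⊆ gr M)
    (hBg : B ⊆ gr M) (hdisj : (B ∩ K).card = 0) : crk M B + B.card + 1 ≤ (gr M).card := by
  have hKsub : K ⊆ gr M \ B := by
    intro k hk
    rw [Finset.mem_sdiff]
    refine ⟨hKg hk, fun hkB => ?_⟩
    have : k ∈ B ∩ K := Finset.mem_inter.mpr ⟨hkB, hk⟩
    rw [Finset.card_eq_zero] at hdisj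
    rw [hdisj] at this
    exact Finset.notMem_empty _ this
  have h1 : crk M B + 1 ≤ (gr M \ B).card := rkN_add_one_le_card_of_subset hK3 hKrk hKsub
  have h2 : (gr M \ B).card = (gr M).card - B.card := Finset.card_sdiff_of_subset hBg
  have h3 : B.card ≤ (gr M).card := Finset.card_le_card hBg
  omega

omit [DecidableEq α] in
/-- Membership in the level set from `rkN`. -/
theorem mem_levelSet_of_rkN {u : ℕ} {S : Finset α} (hSg : S ⊆ gr M) (h : rkN M S = u) :
    S ∈ Shadow.levelSet M u := by
  rw [Profile.mem_levelSet]; exact ⟨hSg, rkN_eq_iff.mp h⟩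

/-- The sum of a nonnegative weight over the level-`(q+1)` supersets of `B` dominates its sum over `x ↦ B ∪ {x}`, `x ∈ T`. -/
theorem sum_insert_le_sum_filter {q : ℕ} (w : Finset α → Finset α → ℚ) {B : Finset α} (hw : ∀ S, 0 ≤ w B S)
    (T : Finset α) (hT : ∀ x ∈ T, x ∉ B) (hmem : ∀ x ∈ T, insert x B ∈ Shadow.levelSet M (q + 1)) :
    ∑ x ∈ T, w B (insert x B) ≤ ∑ S ∈ (Shadow.levelSet M (q + 1)).filter (fun S => B ⊆ S), w B S := by
  have hinj : Set.InjOn (fun x => insert x B) (T : Set α) := by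
    intro x hx x' _ hEq
    have hEq' : insert x B = insert x' B := hEq
    exact (Finset.insert_inj (hT x hx)).mp hEq'
  rw [← Finset.sum_image hinj]
  apply Finset.sum_le_sum_of_subset_of_nonneg
  · intro S hS
    rw [Finset.mem_image] at hS
    obtain ⟨x, hx, rfl⟩ := hS
    rw [Finset.mem_filter]
    exact ⟨hmem x hx, Finset.subset_insert _ _⟩
  · intro S _ _; exact hw S

/-- `(S.erase c) ∩ K = (S ∩ K).erase c`. -/
theorem erase_inter_eq (S K : Finset α) (c : α) : (S.erase c) ∩ K = (S ∩ K).erase c := by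
  ext x; simp only [Finset.mem_inter, Finset.mem_erase]; tauto

/-- The card of `(S.erase c) ∩ K` by whether `c ∈ K`. -/
theorem card_erase_inter (S K : Finset α) {c : α} (hc : c ∈ S) :
    ((S.erase c) ∩ K).card = if c ∈ K then (S ∩ K).card - 1 else (S ∩ K).card := by
  rw [erase_inter_eq]
  split_ifs with hcK
  · exact Finset.card_erase_of_mem (Finset.mem_inter.mpr ⟨hc, hcK⟩)
  · rw [Finset.erase_eq_of_notMem]; intro h; exact hcK (Finset.mem_inter.mp h).2

/-- `(gr M ∖ B) ∩ K = K ∖ B` for `K ⊆ gr M`. -/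
theorem sdiff_inter_eq_sdiff {K B : Finset α} (hKg : K ⊆ gr M) : (gr M \ B) ∩ K = K \ B := by
  ext x
  simp only [Finset.mem_inter, Finset.mem_sdiff]
  constructor
  · rintro ⟨⟨_, hxB⟩, hxK⟩; exact ⟨hxK, hxB⟩
  · rintro ⟨hxK, hxB⟩; exact ⟨⟨hKg hxK, hxB⟩, hxK⟩

/-- `|K ∖ B| + |B ∩ K| = |K|`. -/
theorem card_sdiff_add_card_inter' (K B : Finset α) : (K \ B).card + (B ∩ K).card = K.card := by
  rw [Finset.inter_comm]; exact Finset.card_sdiff_add_card_inter K B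

/-- A sum over `T` of a weight that is `a` on `K` and `b` off `K`. -/
theorem sum_ite_mem_eq (T K : Finset α) (a b : ℚ) :
    ∑ x ∈ T, (if x ∈ K then a else b) = ((T ∩ K).card : ℚ) * a + ((T \ K).card : ℚ) * b := by
  rw [Finset.sum_ite, Finset.sum_const, Finset.sum_const, nsmul_eq_mul, nsmul_eq_mul,
    Finset.filter_mem_eq_inter, ← Finset.sdiff_eq_filter]

/-- **(Dem), type a** (`|B| = q + 1`, `K ⊆ B`): `ρ(E ∖ B) ≤ Σ_S w B S`. -/
theorem dem_a {q : ℕ} {K : Finset α} (hK3 : K.card = 3) (hKrk : rkN M K = 2)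
    (hclass : ∀ X ⊆ gr M, X.card ≤ q + 2 → ¬ K ⊆ X → rkN M X = X.card)
    (w : Finset α → Finset α → ℚ) (hw_nonneg : ∀ B S, 0 ≤ w B S)
    (hw_a : ∀ B S : Finset α, B.card = q + 1 → (B ∩ K).card = 3 → S.card = q + 2 → w B S = 1)
    {B : Finset α} (hBg : B ⊆ gr M) (hBc : B.card = q + 1) (hKB : K ⊆ B) :
    (crk M B : ℚ) ≤ ∑ S ∈ (Shadow.levelSet M (q + 1)).filter (fun S => B ⊆ S), w B S := by
  set T := gr M \ B with hT
  have hTx : ∀ x ∈ T, x ∉ B := fun x hx => (Finset.mem_sdiff.mp hx).2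
  have hmem : ∀ x ∈ T, insert x B ∈ Shadow.levelSet M (q + 1) := by
    intro x hx
    have hxg : x ∈ gr M := (Finset.mem_sdiff.mp hx).1
    have hc : (insert x B).card = q + 2 := by rw [Finset.card_insert_of_notMem (hTx x hx), hBc]
    apply mem_levelSet_of_rkN (Finset.insert_subset hxg hBg)
    have := rkN_add_one_eq_card_of_subset hK3 hKrk hclass (Finset.insert_subset hxg hBg) (by omega)
      (hKB.trans (Finset.subset_insert x B))
    omega
  have h1 := sum_insert_le_sum_filter (M := M) (q := q) w (fun S => hw_nonneg B S) T hTx hmem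
  have h2 : ∑ x ∈ T, w B (insert x B) = (T.card : ℚ) := by
    rw [Finset.sum_congr rfl (fun x hx => hw_a B (insert x B) hBc ((subset_iff_card_inter_eq hK3).mp hKB)
      (by rw [Finset.card_insert_of_notMem (hTx x hx), hBc]))]
    rw [Finset.sum_const, nsmul_eq_mul, mul_one]
  have h3 : crk M B ≤ T.card := by
    have := crk_add_card_le B hBg
    rw [hT, Finset.card_sdiff_of_subset hBg]
    omega
  have h4 : (crk M B : ℚ) ≤ T.card := by exact_mod_cast h3
  linarith

/-- **(Dem), type 2K** (`|B| = q`, `|B ∩ K| = 2`): `ρ(E ∖ B) ≤ Σ_S w B S` when `f (s_I + s_Q) ≥ f + 1`. -/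
theorem dem_twoK {q : ℕ} {K : Finset α} (hKg : K ⊆ gr M) (hK3 : K.card = 3) (hKrk : rkN M K = 2)
    (hclass : ∀ X ⊆ gr M, X.card ≤ q + 2 → ¬ K ⊆ X → rkN M X = X.card)
    (w : Finset α → Finset α → ℚ) (hw_nonneg : ∀ B S, 0 ≤ w B S) (sI sQ : ℚ)
    (hw_2I : ∀ B S : Finset α, B.card = q → (B ∩ K).card = 2 → S.card = q + 1 → w B S = sI)
    (hw_2Q : ∀ B S : Finset α, B.card = q → (B ∩ K).card = 2 → S.card = q + 2 → (S ∩ K).card = 3 → w B S = sQ)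
    (hdem : (((gr M).card - q - 1 : ℕ) : ℚ) + 1 ≤ (((gr M).card - q - 1 : ℕ) : ℚ) * (sI + sQ))
    {B : Finset α} (hBg : B ⊆ gr M) (hBc : B.card = q) (hBK : (B ∩ K).card = 2) :
    (crk M B : ℚ) ≤ ∑ S ∈ (Shadow.levelSet M (q + 1)).filter (fun S => B ⊆ S), w B S := by
  have hKB1 : (K \ B).card = 1 := by have := card_sdiff_add_card_inter' K B; omega
  obtain ⟨y, hy⟩ := Finset.card_eq_one.mp hKB1
  have hyK : y ∈ K := (Finset.mem_sdiff.mp (hy ▸ Finset.mem_singleton_self y)).1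
  have hyB : y ∉ B := (Finset.mem_sdiff.mp (hy ▸ Finset.mem_singleton_self y)).2
  have hyg : y ∈ gr M := hKg hyK
  set T := (gr M \ B).erase y with hT
  have hTx : ∀ x ∈ T, x ∉ B := fun x hx => (Finset.mem_sdiff.mp (Finset.mem_of_mem_erase hx)).2
  have hTy : ∀ x ∈ T, x ≠ y := fun x hx => Finset.ne_of_mem_erase hx
  have hTg : ∀ x ∈ T, x ∈ gr M := fun x hx => (Finset.mem_sdiff.mp (Finset.mem_of_mem_erase hx)).1
  have hTcard : T.card = (gr M).card - q - 1 := by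
    rw [hT, Finset.card_erase_of_mem (Finset.mem_sdiff.mpr ⟨hyg, hyB⟩), Finset.card_sdiff_of_subset hBg, hBc]
  -- the sets B ∪ {x}
  have hmem1 : ∀ x ∈ T, insert x B ∈ Shadow.levelSet M (q + 1) := by
    intro x hx
    have hc : (insert x B).card = q + 1 := by rw [Finset.card_insert_of_notMem (hTx x hx), hBc]
    apply mem_levelSet_of_rkN (Finset.insert_subset (hTg x hx) hBg)
    rw [hclass _ (Finset.insert_subset (hTg x hx) hBg) (by omega) ?_, hc]
    intro hKS
    have : y ∈ insert x B := hKS hyK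
    rw [Finset.mem_insert] at this
    rcases this with h | h
    · exact hTy x hx h.symm
    · exact hyB h
  -- the sets B ∪ {y, x}
  have hyB' : ∀ x ∈ T, x ∉ insert y B := by
    intro x hx h
    rw [Finset.mem_insert] at h
    rcases h with h | h
    · exact hTy x hx h
    · exact hTx x hx h
  have hKS2 : ∀ x ∈ T, K ⊆ insert x (insert y B) := by
    intro x _ k hk
    by_cases hkB : k ∈ B
    · exact Finset.mem_insert_of_mem (Finset.mem_insert_of_mem hkB)
    · have : k ∈ K \ B := Finset.mem_sdiff.mpr ⟨hk, hkB⟩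
      rw [hy, Finset.mem_singleton] at this
      rw [this]; exact Finset.mem_insert_of_mem (Finset.mem_insert_self y B)
  have hc2 : ∀ x ∈ T, (insert x (insert y B)).card = q + 2 := by
    intro x hx
    rw [Finset.card_insert_of_notMem (hyB' x hx), Finset.card_insert_of_notMem hyB, hBc]
  have hmem2 : ∀ x ∈ T, insert x (insert y B) ∈ Shadow.levelSet M (q + 1) := by
    intro x hx
    have hsub : insert x (insert y B) ⊆ gr M := Finset.insert_subset (hTg x hx) (Finset.insert_subset hyg hBg)
    apply mem_levelSet_of_rkN hsub
    have := rkN_add_one_eq_card_of_subset hK3 hKrk hclass hsub (by rw [hc2 x hx]) (hKS2 x hx)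
    rw [hc2 x hx] at this
    omega
  set rng := (Shadow.levelSet M (q + 1)).filter (fun S => B ⊆ S) with hrng
  set img1 := T.image (fun x => insert x B) with himg1
  set img2 := T.image (fun x => insert x (insert y B)) with himg2
  have hinj1 : Set.InjOn (fun x => insert x B) (T : Set α) := by
    intro x hx x' _ hEq
    exact (Finset.insert_inj (hTx x hx)).mp hEq
  have hinj2 : Set.InjOn (fun x => insert x (insert y B)) (T : Set α) := by
    intro x hx x' _ hEq
    exact (Finset.insert_inj (hyB' x hx)).mp hEq
  have hsub1 : img1 ⊆ rng := by
    intro S hS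
    rw [himg1, Finset.mem_image] at hS
    obtain ⟨x, hx, rfl⟩ := hS
    rw [hrng, Finset.mem_filter]
    exact ⟨hmem1 x hx, Finset.subset_insert _ _⟩
  have hsub2 : img2 ⊆ rng := by
    intro S hS
    rw [himg2, Finset.mem_image] at hS
    obtain ⟨x, hx, rfl⟩ := hS
    rw [hrng, Finset.mem_filter]
    exact ⟨hmem2 x hx, (Finset.subset_insert y B).trans (Finset.subset_insert _ _)⟩
  have hdisj : Disjoint img1 img2 := by
    rw [Finset.disjoint_left]
    intro S h1 h2
    rw [himg1, Finset.mem_image] at h1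
    rw [himg2, Finset.mem_image] at h2
    obtain ⟨x, hx, rfl⟩ := h1
    obtain ⟨x', hx', hEq⟩ := h2
    have e1 : (insert x B).card = q + 1 := by rw [Finset.card_insert_of_notMem (hTx x hx), hBc]
    have e2 := hc2 x' hx'
    rw [hEq] at e2
    omega
  have hunion : img1 ∪ img2 ⊆ rng := Finset.union_subset hsub1 hsub2
  have hle : ∑ S ∈ img1 ∪ img2, w B S ≤ ∑ S ∈ rng, w B S :=
    Finset.sum_le_sum_of_subset_of_nonneg hunion (fun S _ _ => hw_nonneg B S)
  rw [Finset.sum_union hdisj] at hle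
  have e1 : ∑ S ∈ img1, w B S = (T.card : ℚ) * sI := by
    rw [himg1, Finset.sum_image hinj1]
    rw [Finset.sum_congr rfl (fun x hx => hw_2I B (insert x B) hBc hBK
      (by rw [Finset.card_insert_of_notMem (hTx x hx), hBc]))]
    rw [Finset.sum_const, nsmul_eq_mul]
  have e2 : ∑ S ∈ img2, w B S = (T.card : ℚ) * sQ := by
    rw [himg2, Finset.sum_image hinj2]
    rw [Finset.sum_congr rfl (fun x hx => hw_2Q B (insert x (insert y B)) hBc hBK (hc2 x hx)
      ((subset_iff_card_inter_eq hK3).mp (hKS2 x hx)))]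
    rw [Finset.sum_const, nsmul_eq_mul]
  have h3 : crk M B ≤ (gr M).card - q - 1 + 1 := by
    have := crk_add_card_le B hBg
    have hn : q + 1 ≤ (gr M).card := by
      have := Finset.card_le_card (Finset.insert_subset hyg hBg)
      rw [Finset.card_insert_of_notMem hyB, hBc] at this
      exact this
    omega
  have h4 : (crk M B : ℚ) ≤ (((gr M).card - q - 1 : ℕ) : ℚ) + 1 := by exact_mod_cast h3
  rw [hTcard] at e1 e2
  linarith

/-- **(Dem), types G and Z** (`|B| = q`, `|B ∩ K| ≤ 1`): the sum over `x ↦ B ∪ {x}`, `x ∈ E ∖ B`, split by `x ∈ K`. -/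
theorem dem_small {q : ℕ} {K : Finset α} (hKg : K ⊆ gr M) (hK3 : K.card = 3)
    (hclass : ∀ X ⊆ gr M, X.card ≤ q + 2 → ¬ K ⊆ X → rkN M X = X.card)
    (w : Finset α → Finset α → ℚ) (hw_nonneg : ∀ B S, 0 ≤ w B S) (a b : ℚ) {m : ℕ} (hm : m ≤ 1)
    (hwa : ∀ B S : Finset α, B.card = q → (B ∩ K).card = m → S.card = q + 1 → (S ∩ K).card = m + 1 → w B S = a)
    (hwb : ∀ B S : Finset α, B.card = q → (B ∩ K).card = m → S.card = q + 1 → (S ∩ K).card = m → w B S = b)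
    {B : Finset α} (hBg : B ⊆ gr M) (hBc : B.card = q) (hBK : (B ∩ K).card = m) :
    (((3 - m : ℕ) : ℚ) * a + (((gr M).card - q - (3 - m) : ℕ) : ℚ) * b) ≤
      ∑ S ∈ (Shadow.levelSet M (q + 1)).filter (fun S => B ⊆ S), w B S := by
  set T := gr M \ B with hT
  have hTx : ∀ x ∈ T, x ∉ B := fun x hx => (Finset.mem_sdiff.mp hx).2
  have hTg : ∀ x ∈ T, x ∈ gr M := fun x hx => (Finset.mem_sdiff.mp hx).1
  have hTcard : T.card = (gr M).card - q := by rw [hT, Finset.card_sdiff_of_subset hBg, hBc]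
  have hTK : (T ∩ K).card = 3 - m := by
    rw [hT, sdiff_inter_eq_sdiff hKg]
    have := card_sdiff_add_card_inter' K B
    omega
  have hTK' : (T \ K).card = (gr M).card - q - (3 - m) := by
    have := Finset.card_sdiff_add_card_inter T K
    omega
  -- the intersection of `B ∪ {x}` with `K`
  have hinter : ∀ x ∈ T, ((insert x B) ∩ K).card = if x ∈ K then m + 1 else m := by
    intro x hx
    split_ifs with hxK
    · rw [Finset.insert_inter_of_mem hxK, Finset.card_insert_of_notMem (fun h => hTx x hx (Finset.mem_inter.mp h).1), hBK]
    · rw [Finset.insert_inter_of_notMem hxK, hBK]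
  have hmem : ∀ x ∈ T, insert x B ∈ Shadow.levelSet M (q + 1) := by
    intro x hx
    have hc : (insert x B).card = q + 1 := by rw [Finset.card_insert_of_notMem (hTx x hx), hBc]
    apply mem_levelSet_of_rkN (Finset.insert_subset (hTg x hx) hBg)
    rw [hclass _ (Finset.insert_subset (hTg x hx) hBg) (by omega) ?_, hc]
    intro hKS
    have h1 := (subset_iff_card_inter_eq hK3).mp hKS
    have h2 := hinter x hx
    rw [h1] at h2
    split_ifs at h2 <;> omega
  have h1 := sum_insert_le_sum_filter (M := M) (q := q) w (fun S => hw_nonneg B S) T hTx hmem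
  have h2 : ∑ x ∈ T, w B (insert x B) = ∑ x ∈ T, (if x ∈ K then a else b) := by
    apply Finset.sum_congr rfl
    intro x hx
    have hc : (insert x B).card = q + 1 := by rw [Finset.card_insert_of_notMem (hTx x hx), hBc]
    have hi := hinter x hx
    split_ifs with hxK
    · rw [if_pos hxK] at hi; exact hwa B _ hBc hBK hc hi
    · rw [if_neg hxK] at hi; exact hwb B _ hBc hBK hc hi
  rw [h2, sum_ite_mem_eq, hTK, hTK'] at h1
  exact h1

end OneCircuit
end PercRepro
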